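import Mathlib
import HarnessLib

/-!
# ValiantsHypothesis / FreeSubtorus — crux `OrbitDimensionBound` (stmt-ValiantsHypothesis-16133), rung line
# `Cruxes/OrbitDimensionBound/Lines/sign_covering.lean`, stub `stub_signDiagonalise`: step 1 — SIMULTANEOUS
# ±1-EIGENBASES OF COMMUTING INVOLUTIONS and CHARACTERS OF SUBGROUPS OF `𝔽₂^N`

Linear-algebra tools for the bookkeeping stub `stub_signDiagonalise` (a homomorphic lift of the elementary
abelian sign group `S_Λ` puts an affine matrix in sign-graded form).  Helper of the item
(`--supports stmt-ValiantsHypothesis-16133 --as helper`); 0 definitions, 0 named facts: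
* `maxGenEigenspace_eq_eigenspace_of_sq` — an involution is semisimple (Mathlib: `X² − 1` is separable);
* `exists_common_signBasis` — **a commuting family of involutions of `ℂ^m` has a common eigenbasis with
  eigenvalues `±1`**: an invertible `C` and signs `χ k i ∈ {±1}` with `D_i C = C · diag(χ · i)` (Mathlib's
  simultaneous generalised eigenspaces `iSup_iInf_maxGenEigenspace_eq_top_of_…_of_commute`,
  `independent_iInf_maxGenEigenspace_of_forall_mapsTo`, `DirectSum.IsInternal.collectedBasis`);
* `exists_pair_eq_of_additive` — **a character of a subgroup `S ≤ 𝔽₂^N` is `s ↦ ⟨β, s⟩` for some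
  `β ∈ 𝔽₂^N`** (extension of linear functionals from the `𝔽₂`-subspace `S`, `LinearMap.exists_extend`).

Honest framing: bookkeeping; the line's cores `stub_signLinearise`, `stub_signCount`, the crux
`OrbitDimensionBound` and `VP ≠ VNP` remain OPEN.
-/

noncomputable section

set_option linter.dupNamespace false

namespace Summit.ValiantsHypothesis.ValiantsHypothesis.Theorems.FreeSubtorusOrbitDimensionBound.SignDiagonalise

open Module Module.End

/-! ### Involutions are semisimple -/

/-- For an involution `f² = 1` of a finite-dimensional complex vector space, generalised eigenspaces are
eigenspaces. [folklore] -/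
theorem maxGenEigenspace_eq_eigenspace_of_sq {V : Type*} [AddCommGroup V] [Module ℂ V]
    [FiniteDimensional ℂ V] (f : Module.End ℂ V) (hf : f * f = 1) (μ : ℂ) :
    f.maxGenEigenspace μ = f.eigenspace μ := by
  have hsep : (Polynomial.X ^ 2 - Polynomial.C (1 : ℂ)).Separable :=
    Polynomial.separable_X_pow_sub_C (1 : ℂ) (by norm_num) one_ne_zero
  have haeval : Polynomial.aeval f (Polynomial.X ^ 2 - Polynomial.C (1 : ℂ)) = 0 := by
    simp only [map_sub, map_pow, Polynomial.aeval_X, map_one]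
    rw [sq, hf, sub_self]
  have hss : f.IsSemisimple := isSemisimple_of_squarefree_aeval_eq_zero hsep.squarefree haeval
  exact (isFinitelySemisimple_iff_isSemisimple.mpr hss).maxGenEigenspace_eq_eigenspace μ

/-! ### A common `±1`-eigenbasis of commuting involutions -/

/-- **Commuting involutions are simultaneously diagonalisable with eigenvalues `±1`.**  For a family of
matrices `D_i` with `D_i² = 1` and `D_i D_j = D_j D_i` there are an invertible `C` and signs
`χ k i ∈ {1, -1}` with `D_i C = C · diag(k ↦ χ k i)` for every `i` (the columns of `C` form a common
eigenbasis). [folklore] -/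
theorem exists_common_signBasis {ι : Type*} {m : ℕ} (D : ι → Matrix (Fin m) (Fin m) ℂ)
    (hcomm : ∀ i j, D i * D j = D j * D i) (hsq : ∀ i, D i * D i = 1) :
    ∃ C : Matrix (Fin m) (Fin m) ℂ, IsUnit C ∧ ∃ χ : Fin m → ι → ℂ,
      (∀ k i, χ k i = 1 ∨ χ k i = -1) ∧ ∀ i, D i * C = C * Matrix.diagonal (fun k => χ k i) := by
  classical
  let f : ι → Module.End ℂ (Fin m → ℂ) := fun i => Matrix.toLin' (D i)
  have hf : ∀ i, f i = Matrix.toLin' (D i) := fun i => rfl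
  have hfcomm : ∀ i j, Commute (f i) (f j) := by
    intro i j
    change f i * f j = f j * f i
    rw [hf, hf, Module.End.mul_eq_comp, Module.End.mul_eq_comp, ← Matrix.toLin'_mul, hcomm,
      Matrix.toLin'_mul]
  have hfsq : ∀ i, f i * f i = 1 := by
    intro i
    rw [hf, Module.End.mul_eq_comp, ← Matrix.toLin'_mul, hsq, Matrix.toLin'_one]
    rfl
  -- joint generalised eigenspaces span and are independent
  let V : (ι → ℂ) → Submodule ℂ (Fin m → ℂ) := fun χ => ⨅ i, (f i).maxGenEigenspace (χ i)
  have hV : ∀ χ, V χ = ⨅ i, (f i).maxGenEigenspace (χ i) := fun χ => rfl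
  have htop : ⨆ χ : ι → ℂ, V χ = ⊤ :=
    iSup_iInf_maxGenEigenspace_eq_top_of_iSup_maxGenEigenspace_eq_top_of_commute f
      (fun i j _ => hfcomm i j) (fun i => iSup_maxGenEigenspace_eq_top (f i))
  have hind : iSupIndep V :=
    independent_iInf_maxGenEigenspace_of_forall_mapsTo f
      (fun i j φ => mapsTo_maxGenEigenspace_of_comm (hfcomm j i) φ)
  have hint : DirectSum.IsInternal V :=
    DirectSum.isInternal_submodule_of_iSupIndep_of_iSup_eq_top hind htop
  -- a basis adapted to the decomposition, reindexed by `Fin m`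
  let b₀ := hint.collectedBasis fun χ => Module.finBasis ℂ (V χ)
  haveI : Finite (Σ χ : ι → ℂ, Fin (Module.finrank ℂ (V χ))) := Module.Finite.finite_basis b₀
  have hcard : Nat.card (Σ χ : ι → ℂ, Fin (Module.finrank ℂ (V χ))) = m := by
    rw [← Module.finrank_eq_nat_card_basis b₀, Module.finrank_fin_fun]
  let e := (Finite.equivFin _).trans (finCongr hcard)
  let b : Module.Basis (Fin m) ℂ (Fin m → ℂ) := b₀.reindex e
  -- eigenvalue functions of the basis vectors
  let χ : Fin m → ι → ℂ := fun k => (e.symm k).1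
  have hmem : ∀ k i, b k ∈ (f i).eigenspace (χ k i) := by
    intro k i
    have h1 : b k ∈ V (e.symm k).1 := by
      rw [Module.Basis.reindex_apply]
      exact hint.collectedBasis_mem _ (e.symm k)
    rw [hV, Submodule.mem_iInf] at h1
    have h2 := h1 i
    rwa [maxGenEigenspace_eq_eigenspace_of_sq (f i) (hfsq i)] at h2
  have heig : ∀ k i, f i (b k) = χ k i • b k := fun k i => mem_eigenspace_iff.mp (hmem k i)
  have hsign : ∀ k i, χ k i = 1 ∨ χ k i = -1 := by
    intro k i
    have h1 : b k = (χ k i * χ k i) • b k := by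
      conv_lhs => rw [← Module.End.one_apply (R := ℂ) (b k), ← hfsq i, Module.End.mul_apply, heig,
        map_smul, heig, smul_smul]
    have h2 : (χ k i * χ k i - 1) • b k = 0 := by rw [sub_smul, one_smul, ← h1, sub_self]
    have h3 : χ k i * χ k i - 1 = 0 := by
      rcases smul_eq_zero.mp h2 with h | h
      · exact h
      · exact absurd h (b.ne_zero k)
    have h4 : (χ k i - 1) * (χ k i + 1) = 0 := by ring_nf; ring_nf at h3; linear_combination h3
    rcases mul_eq_zero.mp h4 with h | h
    · left; exact sub_eq_zero.mp h
    · right; exact eq_neg_of_add_eq_zero_left h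
  -- the matrix whose columns are the basis vectors
  let C : Matrix (Fin m) (Fin m) ℂ := Matrix.of fun a k => b k a
  have hC : C = (Pi.basisFun ℂ (Fin m)).toMatrix b := by
    ext a k
    simp [C, Module.Basis.toMatrix_apply, Pi.basisFun_repr]
  have hCunit : IsUnit C := by
    rw [hC]
    haveI := (Pi.basisFun ℂ (Fin m)).invertibleToMatrix b
    exact isUnit_of_invertible _
  refine ⟨C, hCunit, χ, hsign, fun i => ?_⟩
  ext a k
  rw [Matrix.mul_diagonal, Matrix.mul_apply]
  have h := congrArg (fun v : Fin m → ℂ => v a) (heig k i)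
  simp only [hf, Matrix.toLin'_apply, Matrix.mulVec, dotProduct, Pi.smul_apply, smul_eq_mul] at h
  simp only [C, Matrix.of_apply]
  rw [h, mul_comm]

/-! ### Characters of subgroups of `𝔽₂^N` -/

/-- **Character extension over `𝔽₂`.**  If `S ⊆ 𝔽₂^N` contains `0` and is closed under addition, and
`ε : 𝔽₂^N → 𝔽₂` is additive on `S`, then there is `β ∈ 𝔽₂^N` with `ε s = Σ_x β_x s_x` for all `s ∈ S`
(a linear functional on the subspace `S` extends to `𝔽₂^N`). [folklore] -/
theorem exists_pair_eq_of_additive {N : Type*} [Fintype N] [DecidableEq N] (S : Set (N → ZMod 2))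
    (h0 : (0 : N → ZMod 2) ∈ S) (hadd : ∀ s ∈ S, ∀ t ∈ S, s + t ∈ S)
    (ε : (N → ZMod 2) → ZMod 2) (hε : ∀ s ∈ S, ∀ t ∈ S, ε (s + t) = ε s + ε t) :
    ∃ β : N → ZMod 2, ∀ s ∈ S, ε s = ∑ x, β x * s x := by
  classical
  -- `S` as a submodule over `𝔽₂`
  let W : Submodule (ZMod 2) (N → ZMod 2) :=
    { carrier := S
      zero_mem' := h0
      add_mem' := fun {a b} ha hb => hadd a ha b hb
      smul_mem' := by
        intro c a ha
        have hc : c = 0 ∨ c = 1 := by decide +revert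
        rcases hc with rfl | rfl
        · rw [zero_smul]; exact h0
        · rw [one_smul]; exact ha }
  have hW : ∀ s, s ∈ W ↔ s ∈ S := fun s => Iff.rfl
  -- `ε` as a linear map on `W`
  let φ : W →ₗ[ZMod 2] ZMod 2 :=
    { toFun := fun s => ε s
      map_add' := fun a b => hε a a.2 b b.2
      map_smul' := by
        intro c a
        have h00 : ε 0 = 0 := by
          have h := hε 0 h0 0 h0
          rw [add_zero] at h
          have : ε 0 + ε 0 = ε 0 + 0 := by rw [← h, add_zero]
          exact add_left_cancel this
        have hc : c = 0 ∨ c = 1 := by decide +revert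
        rcases hc with rfl | rfl
        · change ε ((0 : ZMod 2) • (a : N → ZMod 2)) = 0 • ε a
          rw [zero_smul, zero_smul, h00]
        · change ε ((1 : ZMod 2) • (a : N → ZMod 2)) = 1 • ε a
          rw [one_smul, one_smul] }
  obtain ⟨g, hg⟩ := LinearMap.exists_extend φ
  refine ⟨fun x => g (Pi.single x 1), fun s hs => ?_⟩
  have h1 : ε s = g s := (LinearMap.congr_fun hg ⟨s, hs⟩).symm
  rw [h1, LinearMap.pi_apply_eq_sum_univ g s]
  refine Finset.sum_congr rfl fun x _ => ?_
  rw [smul_eq_mul, mul_comm]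
  congr 2
  funext j
  simp [Pi.single_apply, eq_comm]

end Summit.ValiantsHypothesis.ValiantsHypothesis.Theorems.FreeSubtorusOrbitDimensionBound.SignDiagonalise

end
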